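import Literature.MathematicalPhysics.QuantumFieldTheory.Balaban1983to89.B8Eq1101DentedCubeMemberRealM4
import Literature.MathematicalPhysics.QuantumFieldTheory.Balaban1983to89.B8Real1DentedCubeMember
import Literature.MathematicalPhysics.QuantumFieldTheory.Balaban1983to89.B8Thm32GBoundCubeMemberHolds

/-!
# `Balaban1983to89.B8Eq1101DentedCubeMemberRealPrinted` — [Balaban1985RegularSpaces] (1.101) ∕ [Balaban1985BackgroundPropagators] THEOREM 3.1 AT `U = 1` ON THE DENTED CUBE
# MEMBER `{Ω′_j}` OF [Balaban1985Variational] (148)–(150), PRINTED WEIGHTS: the two named facts `B8Real1DentedCubeMember.Real1DentedCubeMemberPrinted d ℓ` and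
# `Real1M4DentedCubeMemberPrinted d ℓ` (p669491) HOLD for every `L = ℓ + 1 ≥ 2` — the last two named inputs of the (β) crown

statement-level skeleton of published theorems with citation tags; proofs where landed; nothing here is a claim about the Yang–Mills mass gap

`[Balaban1985RegularSpaces]` ("B8" = [6], CMP **99** (1985) 75–102) (1.101) p. 93, (1.91)–(1.92) p. 91, p. 98, (1.131) p. 99; `[Balaban1985BackgroundPropagators]` ([4], CMP **99**
(1985) 389–434) Theorem 3.1 (3.42) p. 397, (3.47) p. 398; `[Balaban1984PropagatorsII]` ("B6", CMP **96** (1984) 223–250) (2.14) p. 225, Prop. 2.2 (2.67) p. 234;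
`[Balaban1985Variational]` ("[15]", CMP **102** (1985) 277–309) (148)–(151) p. 301.  PDFs held (`paper:balaban1985-cmp99-…`, `…-cmp102-…`).

CITATION HEADER (lean-in-tree rule).  Cell `pub-ymgap` (D-0062), node N05 = [B8], seat `pub-ymgap-dag-n05-e` (g32; row s3b; (d2-f) the dented parametrix, file 8; g31 HANDOFF
«Next 1 (iii)», dag-n05-c STANDING GO I.42366, INTENT I.43617).  WHY THIS FILE.  The (β) crown `B8Prop6DentedCubeMemberScalarGammaOfReal1.gaugedBoundB8D_dentedMember_scalar_γ_of_real1Dented`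
(p674270) is conditional exactly on `hR1 : Real1DentedCubeMemberPrinted (d−1) (L−1)` and `hR1' : Real1M4DentedCubeMemberPrinted (d−1) (L−1)` — [4] Thm 3.1 ∕ [6] (1.101) for `T⁻¹` on
[15]'s `{Ω′_j}` at the printed weights.  Files 4–7 of this unit proved both in the general-weights shape (`ineq1101_dentedCubeMember_real`, `ineq1101_dentedCubeMember_m4`); THIS
FILE substitutes the printed weights `a := awPrinted ℓ`, `c := (8L²∕(L²−1), 8, 8, …)`, `w := wPrinted d ℓ η` (G10's all-level windows `awPrinted_window_all ∕ cPrinted_window ∕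
awPrinted_succ_all`, F4e's `wPrinted_facts`) — the dented twin of F4e `ineq1101_cubeMember_real_printed` ∕ `ineq1101_cubeMember_m4_printed`.

WHAT THIS FILE PROVES (kernel-checked).  ★★★ `real1DentedCubeMemberPrinted_of_one_le (d ℓ) (hℓ : 1 ≤ ℓ) : Real1DentedCubeMemberPrinted d ℓ` and
★★★ `real1M4DentedCubeMemberPrinted_of_one_le (d ℓ) (hℓ : 1 ≤ ℓ) : Real1M4DentedCubeMemberPrinted d ℓ`.
HONEST SCOPE ∕ NOT CLAIMED.  Instantiations by name; the estimates are p21∕r05's hypothesis-free L0 box readings and F3's wall estimate, transferred in files 1–7; count-neutral;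
N05 ∕ N07 NOT discharged; one finite `T⁴` programme at fixed `ε`, Bałaban as printed; nothing continuum ∕ ℝ⁴ ∕ OS ∕ mass-gap ∕ Clay.  No `sorry`, no `def`, no `instance`, no
`notation`.  Unit `pub-ymgap-dag-n05-e` (g32), 2026-08-28.

RELATED IN THE TREE, NOT DUPLICATED (`rg -l 'Eq1101DentedCubeMemberRealPrinted' Balaban1983to89` = 0, 2026-08-28T23:15Z): F4e `B8Eq1101CubeMemberWeights.ineq1101_cubeMember_real_printed`
∕ `B8Eq1101CubeMemberRealM4.ineq1101_cubeMember_m4_printed` (dag-n05-c; the PURE twins), `B8Real1DentedCubeMember` (g31; the TARGETS), files 4–7 of this unit (g32; USED), G10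
`B8Thm32GBoundCubeMemberHolds` §1 (the all-level windows; USED).
-/
noncomputable section

namespace Literature.MathematicalPhysics.QuantumFieldTheory.Balaban1983to89.B8Eq1101DentedCubeMemberRealPrinted

open B8Eq1101CubeMemberWeights (awPrinted wPrinted awPrinted_facts wPrinted_facts)
open B8Thm32GBoundCubeMemberHolds (awPrinted_window_all cPrinted_window awPrinted_succ_all)
open B8Real1DentedCubeMember (Real1DentedCubeMemberPrinted Real1M4DentedCubeMemberPrinted)
open B8Eq1101DentedCubeMemberRealGrad (ineq1101_dentedCubeMember_real)
open B8Eq1101DentedCubeMemberRealM4 (ineq1101_dentedCubeMember_m4)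

variable {d : ℕ}

open Classical in
/-- ★★★ **[4] THEOREM 3.1 ∕ [6] (1.101) FOR `T⁻¹` ON THE DENTED MEMBER, EXPONENTS `−2 → 0` AND `−2 → −1`, PRINTED WEIGHTS — THE NAMED FACT `Real1DentedCubeMemberPrinted d ℓ`
HOLDS** (`L = ℓ + 1 ≥ 2`): file 5's `ineq1101_dentedCubeMember_real` at `a := awPrinted ℓ`, `c := (8L²∕(L²−1), 8, …)`, `w := wPrinted d ℓ η`.
[cite: Balaban1985RegularSpaces, (1.101) p.93, p.98, (1.131) p.99; Balaban1985BackgroundPropagators, Theorem 3.1 (3.42) p.397, (3.47) p.398; Balaban1985Variational, (148)–(151) p.301; Balaban1984PropagatorsII, (2.14) p.225, Prop. 2.2 (2.67) p.234] -/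
theorem real1DentedCubeMemberPrinted_of_one_le (d ℓ : ℕ) (hℓ : 1 ≤ ℓ) : Real1DentedCubeMemberPrinted d ℓ := by
  obtain ⟨BG, ρ₀, M₀, N₀, hBG, -, -, h⟩ := ineq1101_dentedCubeMember_real d ℓ hℓ
  refine ⟨BG, ρ₀, M₀, N₀, hBG, ?_⟩
  intro η hη Mh hMh hM0 K' Ω c R hρd hMd hR hR2 hRN hρbig hanch S hS K hK T hT ρ' r hr hρ' φ hφ0 hφ
  obtain ⟨-, hpos, -, -⟩ := awPrinted_facts hℓ
  obtain ⟨hwpos, hrel, hwwin⟩ := wPrinted_facts d hℓ hη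
  exact h η hη Mh hMh hM0 K' Ω c R hρd hMd hR hR2 hRN hρbig hanch (awPrinted ℓ)
    (fun i => if i = 0 then 8 * ((ℓ : ℝ) + 1) ^ 2 / (((ℓ : ℝ) + 1) ^ 2 - 1) else 8)
    (awPrinted_window_all hℓ) (cPrinted_window hℓ) (awPrinted_succ_all hℓ) hpos (wPrinted d ℓ η) hwpos (fun j _ => hrel j)
    (fun j _ => by rw [hwwin j]; exact awPrinted_window_all hℓ j)
    S hS K hK T hT ρ' r hr hρ' φ hφ0 hφ

#print axioms real1DentedCubeMemberPrinted_of_one_le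

open Classical in
/-- ★★★ **[4] THEOREM 3.1 (3.47) AT `γ = −4` FOR `T⁻¹` ON THE DENTED MEMBER, PRINTED WEIGHTS — THE NAMED FACT `Real1M4DentedCubeMemberPrinted d ℓ` HOLDS** (`L = ℓ + 1 ≥ 2`):
file 7's `ineq1101_dentedCubeMember_m4` at the printed weights.
[cite: Balaban1985RegularSpaces, (1.101) p.93, p.98, (1.131) p.99; Balaban1985BackgroundPropagators, Theorem 3.1 (3.47) p.398; Balaban1985Variational, (148)–(151) p.301; Balaban1984PropagatorsII, (2.14) p.225, Prop. 2.2 (2.67) p.234] -/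
theorem real1M4DentedCubeMemberPrinted_of_one_le (d ℓ : ℕ) (hℓ : 1 ≤ ℓ) : Real1M4DentedCubeMemberPrinted d ℓ := by
  obtain ⟨BG, ρ₀, M₀, N₀, hBG, -, -, h⟩ := ineq1101_dentedCubeMember_m4 d ℓ hℓ
  refine ⟨BG, ρ₀, M₀, N₀, hBG, ?_⟩
  intro η hη Mh hMh hM0 K' Ω c R hρd hMd hR hR2 hRN hρbig hanch S hS K hK T hT u r hr hu
  obtain ⟨-, hpos, -, -⟩ := awPrinted_facts hℓ
  obtain ⟨hwpos, hrel, hwwin⟩ := wPrinted_facts d hℓ hη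
  exact h η hη Mh hMh hM0 K' Ω c R hρd hMd hR hR2 hRN hρbig hanch (awPrinted ℓ)
    (fun i => if i = 0 then 8 * ((ℓ : ℝ) + 1) ^ 2 / (((ℓ : ℝ) + 1) ^ 2 - 1) else 8)
    (awPrinted_window_all hℓ) (cPrinted_window hℓ) (awPrinted_succ_all hℓ) hpos (wPrinted d ℓ η) hwpos (fun j _ => hrel j)
    (fun j _ => by rw [hwwin j]; exact awPrinted_window_all hℓ j)
    S hS K hK T hT u r hr hu

#print axioms real1M4DentedCubeMemberPrinted_of_one_le

end Literature.MathematicalPhysics.QuantumFieldTheory.Balaban1983to89.B8Eq1101DentedCubeMemberRealPrinted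

end
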